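import Mathlib.LinearAlgebra.FiniteDimensional.Lemmas
import Literature.NumberTheory.Transcendental.BrownMotivicMZV
import Literature.NumberTheory.Transcendental.MultipleZetaValuesDimBoundProofs

/-!
# Crux `HoffmanIndependence` (stmt-KontsevichZagierPeriods-15045), line `Sketch` — stub B1:
# the dimension of the filtered pieces `H_{≤K} = ⨆_{k≤K} H_k` of Brown's motivic MZVs

Over `M : Brown2012.MotivicMZV` with independent weight pieces `H_k = M.Hw k` (`hgr`) of dimension
`d_k = zagierDim k` (`hdim`), each spanned by the finitely many motivic Hoffman elements
`J (ρ w.reverse)`, `w ∈ {2,3}^×` of weight `k` (`hhoff` — this is what makes every `H_k`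
finite-dimensional; `hdim` alone does not, `finrank` being `0` on infinite-dimensional spaces and
`d_1 = 0`), the filtered piece `H_{≤K} = ⨆_{k≤K} H_k` has dimension `d_{≤K} = ∑_{k≤K} d_k`.

Proof: induction on `K`, `H_{≤K+1} = H_{K+1} ⊔ H_{≤K}` (`Finset.iSup_insert`) with
`H_{K+1} ⊓ H_{≤K} = ⊥` by independence (`iSupIndep.disjoint_biSup`), and
`Submodule.finrank_sup_add_finrank_inf_eq`.
-/

namespace Summit.KontsevichZagierPeriods.LinRedNormalForm.HoffmanIndependence

open Literature.NumberTheory.Transcendental MZV Brown2012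

/-- Each weight piece `H_N` of `M : MotivicMZV` is finite-dimensional as soon as it is spanned by
the motivic Hoffman elements of weight `N`, a family indexed by the finite type
`{w // IsHoffman w ∧ weight w = N}` (`finite_hoffman`). -/
theorem finiteDimensional_Hw_of_hoffmanSpan (M : MotivicMZV)
    (hhoff : ∀ N, Submodule.span ℚ (Set.range
      fun w : {w : List ℕ // IsHoffman w ∧ weight w = N} => M.J (rho w.1.reverse)) = M.Hw N)
    (N : ℕ) : FiniteDimensional ℚ (M.Hw N) := by
  haveI := finite_hoffman N
  rw [← hhoff N]
  exact FiniteDimensional.span_of_finite ℚ (Set.finite_range _)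

/-- A finite supremum `⨆ k ∈ s, H_k` (`s` a finset) of finite-dimensional weight pieces is
finite-dimensional. -/
theorem finiteDimensional_biSup_finset (M : MotivicMZV) [∀ k, FiniteDimensional ℚ (M.Hw k)]
    (s : Finset ℕ) : FiniteDimensional ℚ ↥(⨆ k ∈ s, M.Hw k) := by
  rw [← Finset.sup_eq_iSup]
  infer_instance

/-- **Stub B1** (dimension of the filtered pieces). With independent weight pieces (`hgr`) of
dimension `d_k` (`hdim`), each spanned by finitely many motivic Hoffman elements (`hhoff`, which
makes every `H_k` finite-dimensional — `hdim` alone does not, `finrank` being `0` on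
infinite-dimensional spaces and `d_1 = 0`), the filtered piece `H_{≤K} = ⨆_{k≤K} H_k` has
dimension `d_{≤K} = ∑_{k≤K} d_k` (induction on `K`: `H_{≤K+1} = H_{K+1} ⊔ H_{≤K}` with
`H_{K+1} ⊓ H_{≤K} = ⊥` by independence, `Submodule.finrank_sup_add_finrank_inf_eq`). -/
theorem stub_finrankFiltered : ∀ (M : MotivicMZV), iSupIndep M.Hw →
    (∀ N, Module.finrank ℚ (M.Hw N) = zagierDim N) →
    (∀ N, Submodule.span ℚ (Set.range
      fun w : {w : List ℕ // IsHoffman w ∧ weight w = N} => M.J (rho w.1.reverse)) = M.Hw N) →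
    ∀ K : ℕ, Module.finrank ℚ ↥(⨆ k ∈ Finset.range (K + 1), M.Hw k) =
      ∑ k ∈ Finset.range (K + 1), zagierDim k := by
  intro M hgr hdim hhoff K
  haveI : ∀ k, FiniteDimensional ℚ (M.Hw k) := finiteDimensional_Hw_of_hoffmanSpan M hhoff
  induction K with
  | zero =>
    have h : (⨆ k ∈ Finset.range (0 + 1), M.Hw k) = M.Hw 0 := by
      rw [Nat.zero_add, Finset.range_one, Finset.iSup_singleton]
    rw [LinearEquiv.finrank_eq (LinearEquiv.ofEq _ _ h), hdim, Nat.zero_add,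
      Finset.sum_range_one]
  | succ K ih =>
    have h : (⨆ k ∈ Finset.range (K + 1 + 1), M.Hw k) =
        M.Hw (K + 1) ⊔ ⨆ k ∈ Finset.range (K + 1), M.Hw k := by
      rw [Finset.range_add_one, Finset.iSup_insert]
    have hdis : M.Hw (K + 1) ⊓ (⨆ k ∈ Finset.range (K + 1), M.Hw k) = ⊥ := by
      refine (hgr.disjoint_biSup (x := K + 1) (y := (↑(Finset.range (K + 1)) : Set ℕ)) ?_).eq_bot
      simp
    haveI := finiteDimensional_biSup_finset M (Finset.range (K + 1))
    have key := Submodule.finrank_sup_add_finrank_inf_eq (M.Hw (K + 1))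
      (⨆ k ∈ Finset.range (K + 1), M.Hw k)
    rw [hdis, finrank_bot, add_zero, hdim, ih] at key
    rw [LinearEquiv.finrank_eq (LinearEquiv.ofEq _ _ h), key, Finset.sum_range_succ _ (K + 1),
      add_comm]

end Summit.KontsevichZagierPeriods.LinRedNormalForm.HoffmanIndependence
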